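import Summits.MatrixMultiplication.MatrixMultiplication.Theses.NilpotentLieHosts
import Literature.Computability.AlgebraicComplexity.BCGPUInfiniteGroupsProofs
import Literature.Computability.AlgebraicComplexity.AsymptoticSumInequalityAsymptoticRank
import Literature.Barriers.MatrixMultiplication.UniversalMethodBarrierAsymptoticRank

/-!
# Route `NilpotentLieHosts` — support item `HostingBound` (proved)

Item `stmt-MatrixMultiplication-7726` of route `MatrixMultiplication/NilpotentLieHosts`: the abstract
core of Cohn–Umans 2003, Thm. 4.1 / Blasiak–Cohn–Grochow–Pratt–Umans 2024, Thm. 2.2 with Remark 2.4.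
If `ℂ`-linear maps `α : ℂ^{n×m} → A`, `β : ℂ^{m×p} → A`, `γ : A → ℂ^{n×p}` into a `ℂ`-algebra `A`
with a finite basis `b` satisfy the hosting identity `γ(α(M)·β(N)) = M·N`, then
`(nmp)^{ω/3} ≤ R̃(structureTensor b)`.

Proof (all ingredients are in the tree):

* `⟨n,m,p⟩ ≤ structureTensor b` — the bilinear map `(M, N) ↦ MN` is computed inside `A`
  (`tensorRestrictsTo_structureTensor_of_factors` with the vectors `α(E_{x})`, `β(E_{y})` and the
  linear forms `a ↦ γ(a)_{z}`; the hosting identity on matrix units gives the entries of `⟨n,m,p⟩`);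
* the one-summand direct sum `⊕_{i<1} ⟨n,m,p⟩` (the format of the tree's asymptotic sum
  inequality) is a relabelling of `⟨n,m,p⟩` (`tensorRestrictsTo_matMulTensor_matMulDirectSum_one_rect`);
* `(nmp)^{ω/3} ≤ R̃(⊕_{i<1} ⟨n,m,p⟩)` is `sum_rpow_omega_le_asymptoticRank` (Schönhage's asymptotic
  sum inequality for the asymptotic rank, one summand — this packages the cyclic symmetrisation
  `⟨n,m,p⟩ ⊗ ⟨m,p,n⟩ ⊗ ⟨p,n,m⟩ = ⟨nmp,nmp,nmp⟩` and `R̃(⟨q,q,q⟩) = q^ω`);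
* `R̃` is monotone under restriction (`asymptoticRank_le_of_polyDegeneratesTo` applied to
  `TensorRestrictsTo.polyDegeneratesTo`).

References: [CohnUmans2003, Thm. 2.3, Thm. 4.1], [BlasiakCohnGrochowPrattUmans2024, Thm. 2.2,
Rem. 2.4], [BurgisserClausenShokrollahi1997, §14.2, (15.11), Ex. 15.24(7)], [Strassen1988].
-/

set_option linter.dupNamespace false

noncomputable section

open scoped BigOperators

namespace Summit.MatrixMultiplication.MatrixMultiplication.Theorems

open Literature.Computability.AlgebraicComplexity
open Literature.Barriers.MatrixMultiplication (asymptoticRank_le_of_polyDegeneratesTo)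

/-- The one-summand direct sum `⊕_{i<1} ⟨k,m,n⟩` (`matMulDirectSum` over `Fin 1`) is a relabelling,
hence a restriction, of `⟨k,m,n⟩` (rectangular version of
`tensorRestrictsTo_matMulTensor_matMulDirectSum_one`). -/
theorem tensorRestrictsTo_matMulTensor_matMulDirectSum_one_rect (K : Type) [Field K] (k m n : ℕ) :
    TensorRestrictsTo (matMulTensor K k m n)
      (matMulDirectSum K (fun _ : Fin 1 => k) (fun _ => m) (fun _ => n)) := by
  have key : matMulDirectSum K (fun _ : Fin 1 => k) (fun _ => m) (fun _ => n) =
      fun a b c => matMulTensor K k m n a.2 b.2 c.2 := by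
    funext a b c
    simp only [matMulDirectSum, matMulTensor]
    refine ite_congr_prop ?_
    simp only [Subsingleton.elim a.1 b.1, Subsingleton.elim b.1 c.1, true_and, Fin.ext_iff]
  rw [key]
  exact tensorRestrictsTo_precomp _ _ _ _

/-- **`HostingBound`** (support item `stmt-MatrixMultiplication-7726` of route `NilpotentLieHosts`;
the abstract core of Cohn–Umans 2003, Thm. 4.1 and BCGPU 2024, Thm. 2.2 + Rem. 2.4): if `ℂ`-linear
maps `α : ℂ^{n×m} → A`, `β : ℂ^{m×p} → A`, `γ : A → ℂ^{n×p}` into a `ℂ`-algebra `A` with a finite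
basis `b` satisfy `γ(α(M)·β(N)) = M·N` for all `M, N`, then `(nmp)^{ω/3} ≤ R̃(structureTensor b)`. -/
theorem hostingBound_proof :
    Summit.MatrixMultiplication.MatrixMultiplication.Theses.NilpotentLieHosts.HostingBound := by
  unfold Summit.MatrixMultiplication.MatrixMultiplication.Theses.NilpotentLieHosts.HostingBound
  intro A _ _ ι _ b n m p α β γ hhost
  classical
  -- the linear forms `a ↦ γ(a)_{z}` on `A`, `z ∈ [n] × [p]`
  let γ' : Fin n × Fin p → A →ₗ[ℂ] ℂ := fun z =>
    { toFun := fun a => γ a z.1 z.2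
      map_add' := fun a a' => by simp only [map_add, Matrix.add_apply]
      map_smul' := fun c a => by
        simp only [map_smul, Matrix.smul_apply, smul_eq_mul, RingHom.id_apply] }
  -- Step 1: `⟨n,m,p⟩ ≤ structureTensor b` (hosting identity on matrix units)
  have h1 : TensorRestrictsTo (structureTensor b) (matMulTensor ℂ n m p) := by
    refine tensorRestrictsTo_structureTensor_of_factors b
      (fun x : Fin n × Fin m => α (Matrix.single x.1 x.2 1))
      (fun y : Fin m × Fin p => β (Matrix.single y.1 y.2 1)) γ' _ fun z x y => ?_
    show matMulTensor ℂ n m p z x y =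
      γ (α (Matrix.single x.1 x.2 1) * β (Matrix.single y.1 y.2 1)) z.1 z.2
    rw [hhost, Matrix.mul_apply]
    simp only [matMulTensor, Matrix.single_apply]
    rw [Finset.sum_eq_single x.2]
    · by_cases h₂ : x.2 = y.1
      · by_cases h₁ : z.1 = x.1 <;> by_cases h₃ : z.2 = y.2 <;> simp [h₁, h₂, h₃, eq_comm]
      · rw [if_neg (fun h => h₂ h.2.1), if_neg (c := y.1 = x.2 ∧ y.2 = z.2) (fun h => h₂ h.1.symm),
          mul_zero]
    · intro j _ hj
      simp [Ne.symm hj]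
    · simp
  -- Step 2: `⊕_{i<1} ⟨n,m,p⟩ ≤ ⟨n,m,p⟩ ≤ structureTensor b`
  have h2 : TensorRestrictsTo (structureTensor b)
      (matMulDirectSum ℂ (fun _ : Fin 1 => n) (fun _ => m) (fun _ => p)) :=
    h1.trans (tensorRestrictsTo_matMulTensor_matMulDirectSum_one_rect ℂ n m p)
  -- Step 3: asymptotic sum inequality with one summand, then monotonicity of `R̃`
  have h3 := sum_rpow_omega_le_asymptoticRank ℂ (fun _ : Fin 1 => n) (fun _ => m) (fun _ => p)
  simp only [Finset.univ_unique, Finset.sum_singleton] at h3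
  exact h3.trans (asymptoticRank_le_of_polyDegeneratesTo h2.polyDegeneratesTo)

end Summit.MatrixMultiplication.MatrixMultiplication.Theorems

end
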